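import Summits.QuantumFields.YangMills.Theorems.LuscherReductionTwistedTraceScalingBOStiffBoxBallExit
import Summits.QuantumFields.YangMills.Theorems.LuscherReductionTwistedTraceScalingBOStiffFlatTensor
import HarnessLib

/-!
# (B-ST) ★★★ THE FLAT POINCARÉ INEQUALITY — the `hflat` clause of `spec_gap_inputs` in flat coordinates (Mehler ⊗ gauge resampling, censored to the support, with slack)
# (lane A of S-BASE, crux `TwistedTraceScaling` stmt-QuantumFields-20203, C4-CORE, the (B-ST) pen; HANDOFF-g21 'REMAINING ANALYTIC ATOMS' composition, hand C `…-w3`;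
# HANDOFF-g22 UPDATE 22:20Z «THE ONE REMAINING HYPOTHESIS OF spec_gap_inputs»)

The composition of the `hflat` chain.  FLAT MODEL: stiff coordinates `y ∈ ℝ^σ` with the Mehler pair `D_Y = h₀²`, `J = h₀Kh₀/λ₀` (`K = mehlerKernel a b`, `a_k² + 2a_kb_k = π²`,
contraction `ρ_k = b_k/s_k ≤ ρ < 1`) killed on the box `T = [−R,R]^σ` (window measure `μ = dy|_T`); an abstract finite gauge factor `(Z, κ)` with weight `0 ≤ D_Z ≤ C_Z`,
`M_Z = ∫D_Z dκ > 0`, resampled independently; the support `S ⊆ T × Z` (chart image of `cS`), CORE-STABLE at scale `(t, W)`.  In the lead's reading (HANDOFF-g22): `cD = N̄·θ_Y·h²`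
↔ `D = h₀² ⊗ D_Z` (`D_Z = θ_Y`), `cJ0 ∝ (θ_Yθ_Y') ⊗ (hKh')` ↔ `J₀ = 𝟙_{S×S}·J ⊗ D_ZD_Z'/M_Z`.
* `flatJ_admissible`, `flatJ0_admissible` — the flat kernel `J_flat = J ⊗ D_ZD_Z'/M_Z`, its censoring `J₀ = 𝟙_{S×S}J_flat` and the weight `D = h₀² ⊗ D_Z` are jointly measurable,
  bounded (`(2^{n/2}/λ₀)(C_Z²/M_Z)`, `2^{n/2}C_Z`), non-negative, symmetric (the `Measurable D ∧ |D| ≤ C_D ∧ Measurable J₀ ∧ |J₀| ≤ C_J` data of `spec_gap_inputs`);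
* ★★★ `flat_poincare` — for every bounded measurable `g` vanishing off `S`:
  `∫_S g²D − (∫_S gD)²/∫_S D ≤ P·½∫∫(g(p)−g(q))²J₀ d(μ⊗κ)² + (P·ε_S + ε_R/(1−ρ))·∫_S g²D`,
  `P = max(1/(1−ρ), 1/(1−ε_R))`, `ε_R = 2n·e^{−π(1−ρ)²R²}` (box exit, (B1)), `ε_S = 2n·e^{−πt²} + κ[D_Z𝟙_{Wᶜ}]/M_Z` (support exit, (B2)).
  Chain: ✓`mehler_poincare_box` + ✓`mehlerJ_exit_row` → ✓`variance_tensor_le_slack` (with `D_Y = 𝟙_T h₀²`) → ✓`productWeight_moments`/✓`productJump_eq` → ✓`product_exit_mass_le` →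
  ✓`killed_transfer_door_slack`;
* ★★ `flat_poincare_betaFree` — for `ε_R ≤ 1/2` the β-FREE constant `P₀ = 2/(1−ρ)` and the slack `δ = P₀(ε_S + ε_R) → 0`.
What remains for `hflat` on `(cS, π)` (not this file): the linear chart `cS → S` (Mehler-normalised stiff eigen-coordinates of `(β/2)H`, `ξ_i = y_i√(π/c_i)`; gauge coordinates `z`,
`D_Z = e^{−‖z‖²β²}` on a window) with ✓`coreStable_weightedBall` for the chart image of the Euclidean ball, the (B3) PiDensity transport `vol ↔ π` (w2), and the pointwise comparison
`cJ0 ≥ c·J₀∘chart` from the lead's ✓`cM_lower`/`cK` (magnetic factors `e^{−(β/2)S}` vs the quadratic `e^{−q_β}`).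
HONEST FRAMING: classical Dirichlet-form bookkeeping for a stub of a child of the CONDITIONAL route R2b1; (B-ST) OPEN; C4-CORE OPEN; not infinite volume, not a gap, not Clay.

## References
* A. Wipf, *Statistical Approach to Quantum Field Theory*, LNP 992, Springer 2021, §8.5.1 (8.56)–(8.58) (Mehler kernel and its gap). [Wipf2021]
* M. Fukushima, Y. Oshima, M. Takeda, *Dirichlet Forms and Symmetric Markov Processes*, de Gruyter 2011, §4.4 (part process, killing measure). [FukushimaOshimaTakeda2011]
-/

set_option autoImplicit false

noncomputable section

open MeasureTheory Filter
open scoped Real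

namespace Summit.QuantumFields.YangMills.Theorems.FemtoTransferGap.Mehler

open Literature.Analysis.SegalBargmann

section FlatChain

open StiffDoor

variable {σ : Type*} [Fintype σ] [DecidableEq σ]
variable {Z : Type*} [MeasurableSpace Z] {κ : Measure Z} [IsFiniteMeasure κ]

omit [IsFiniteMeasure κ] in
/-- ★ **The flat product kernel is admissible**: `J_flat(p,q) = J(p₁,q₁)·D_Z(p₂)D_Z(q₂)/M_Z` (`J = h₀Kh₀/λ₀`) is jointly measurable, non-negative, symmetric and bounded by
`(2^{n/2}/λ₀)·(C_Z²/M_Z)`; the flat weight `D = h₀² ⊗ D_Z` is measurable, non-negative and bounded by `2^{n/2}C_Z`. [folklore] -/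
theorem flatJ_admissible {a b : σ → ℝ} (ha : ∀ k, 0 < a k) (hb : ∀ k, 0 < b k) {DZ : Z → ℝ} (hDZ : Measurable DZ) {CZ : ℝ} (hDZb : ∀ z, |DZ z| ≤ CZ)
    (hDZ0 : ∀ z, 0 ≤ DZ z) {MZ : ℝ} (hMZ : 0 < MZ) :
    Measurable (Function.uncurry fun p q : (σ → ℝ) × Z =>
      (hR 0 p.1 * mehlerKernel a b p.1 q.1 * hR 0 q.1 / ∏ k, Real.sqrt (π / (a k + b k + π))) * (DZ p.2 * DZ q.2 / MZ)) ∧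
    (∀ p q : (σ → ℝ) × Z, 0 ≤ (hR 0 p.1 * mehlerKernel a b p.1 q.1 * hR 0 q.1 / ∏ k, Real.sqrt (π / (a k + b k + π))) * (DZ p.2 * DZ q.2 / MZ)) ∧
    (∀ p q : (σ → ℝ) × Z, (hR 0 p.1 * mehlerKernel a b p.1 q.1 * hR 0 q.1 / ∏ k, Real.sqrt (π / (a k + b k + π))) * (DZ p.2 * DZ q.2 / MZ) =
      (hR 0 q.1 * mehlerKernel a b q.1 p.1 * hR 0 p.1 / ∏ k, Real.sqrt (π / (a k + b k + π))) * (DZ q.2 * DZ p.2 / MZ)) ∧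
    (∀ p q : (σ → ℝ) × Z, |(hR 0 p.1 * mehlerKernel a b p.1 q.1 * hR 0 q.1 / ∏ k, Real.sqrt (π / (a k + b k + π))) * (DZ p.2 * DZ q.2 / MZ)| ≤
      (vacCoef σ ^ 2 / ∏ k, Real.sqrt (π / (a k + b k + π))) * (CZ * CZ / MZ)) ∧
    Measurable (fun p : (σ → ℝ) × Z => hR 0 p.1 ^ 2 * DZ p.2) ∧ (∀ p : (σ → ℝ) × Z, 0 ≤ hR 0 p.1 ^ 2 * DZ p.2) ∧
    (∀ p : (σ → ℝ) × Z, |hR 0 p.1 ^ 2 * DZ p.2| ≤ vacCoef σ ^ 2 * CZ) := by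
  obtain ⟨-, hJ0, hJsymm, hJb, hDm, -, hDb, -⟩ := mehlerJ_admissible ha hb
  have hL0 := lambda0_pos ha hb
  have m1 : Measurable fun pq : ((σ → ℝ) × Z) × ((σ → ℝ) × Z) => hR 0 pq.1.1 := continuous_hR_zero.measurable.comp measurable_fst.fst
  have m2 : Measurable fun pq : ((σ → ℝ) × Z) × ((σ → ℝ) × Z) => mehlerKernel a b pq.1.1 pq.2.1 := by
    -- compose WITHOUT an expected type (first-order unification against the kernel would unfold `Real.exp`)
    have h := (continuous_mehlerKernel_uncurry a b).measurable.comp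
      (measurable_fst.fst.prodMk measurable_snd.fst : Measurable fun pq : ((σ → ℝ) × Z) × ((σ → ℝ) × Z) => (pq.1.1, pq.2.1))
    simpa only [Function.comp_def] using h
  have m3 : Measurable fun pq : ((σ → ℝ) × Z) × ((σ → ℝ) × Z) => hR 0 pq.2.1 := continuous_hR_zero.measurable.comp measurable_snd.fst
  have hJ2 : Measurable fun pq : ((σ → ℝ) × Z) × ((σ → ℝ) × Z) => hR 0 pq.1.1 * mehlerKernel a b pq.1.1 pq.2.1 * hR 0 pq.2.1 / ∏ k, Real.sqrt (π / (a k + b k + π)) :=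
    ((m1.mul m2).mul m3).div_const _
  have hD2 : Measurable fun pq : ((σ → ℝ) × Z) × ((σ → ℝ) × Z) => DZ pq.1.2 * DZ pq.2.2 / MZ :=
    ((hDZ.comp measurable_fst.snd).mul (hDZ.comp measurable_snd.snd)).div_const MZ
  have hg0 : ∀ z z' : Z, 0 ≤ DZ z * DZ z' / MZ := fun z z' => div_nonneg (mul_nonneg (hDZ0 z) (hDZ0 z')) hMZ.le
  have hgb : ∀ z z' : Z, |DZ z * DZ z' / MZ| ≤ CZ * CZ / MZ := fun z z' => by
    rw [abs_div, abs_of_pos hMZ, abs_mul]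
    exact div_le_div_of_nonneg_right (mul_le_mul (hDZb z) (hDZb z') (abs_nonneg _) ((abs_nonneg _).trans (hDZb z))) hMZ.le
  refine ⟨hJ2.mul hD2, fun p q => mul_nonneg (hJ0 p.1 q.1) (hg0 p.2 q.2), fun p q => ?_, fun p q => ?_,
    (hDm.comp measurable_fst).mul (hDZ.comp measurable_snd), fun p => mul_nonneg (sq_nonneg _) (hDZ0 p.2), fun p => ?_⟩
  · rw [hJsymm p.1 q.1, mul_comm (DZ p.2) (DZ q.2)]
  · rw [abs_mul]
    exact mul_le_mul (hJb p.1 q.1) (hgb p.2 q.2) (abs_nonneg _) (div_nonneg (sq_nonneg _) hL0.le)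
  · rw [abs_mul]
    exact mul_le_mul (hDb p.1) (hDZb p.2) (abs_nonneg _) ((abs_nonneg _).trans (hDb p.1))

/-- The censored flat kernel `J₀ = 𝟙_{S×S}·J_flat` is jointly measurable, bounded by the same constant, agrees with `J_flat` on `S × S` and vanishes off it. [folklore] -/
theorem flatJ0_admissible {a b : σ → ℝ} (ha : ∀ k, 0 < a k) (hb : ∀ k, 0 < b k) {DZ : Z → ℝ} (hDZ : Measurable DZ) {CZ : ℝ} (hDZb : ∀ z, |DZ z| ≤ CZ)
    (hDZ0 : ∀ z, 0 ≤ DZ z) {MZ : ℝ} (hMZ : 0 < MZ) {S : Set ((σ → ℝ) × Z)} (hS : MeasurableSet S) :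
    Measurable (Function.uncurry fun p q : (σ → ℝ) × Z => (S ×ˢ S).indicator (fun pq : ((σ → ℝ) × Z) × ((σ → ℝ) × Z) =>
      (hR 0 pq.1.1 * mehlerKernel a b pq.1.1 pq.2.1 * hR 0 pq.2.1 / ∏ k, Real.sqrt (π / (a k + b k + π))) * (DZ pq.1.2 * DZ pq.2.2 / MZ)) (p, q)) ∧
    (∀ p q : (σ → ℝ) × Z, |(S ×ˢ S).indicator (fun pq : ((σ → ℝ) × Z) × ((σ → ℝ) × Z) =>
      (hR 0 pq.1.1 * mehlerKernel a b pq.1.1 pq.2.1 * hR 0 pq.2.1 / ∏ k, Real.sqrt (π / (a k + b k + π))) * (DZ pq.1.2 * DZ pq.2.2 / MZ)) (p, q)| ≤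
      (vacCoef σ ^ 2 / ∏ k, Real.sqrt (π / (a k + b k + π))) * (CZ * CZ / MZ)) ∧
    (∀ p ∈ S, ∀ q ∈ S, (S ×ˢ S).indicator (fun pq : ((σ → ℝ) × Z) × ((σ → ℝ) × Z) =>
      (hR 0 pq.1.1 * mehlerKernel a b pq.1.1 pq.2.1 * hR 0 pq.2.1 / ∏ k, Real.sqrt (π / (a k + b k + π))) * (DZ pq.1.2 * DZ pq.2.2 / MZ)) (p, q) =
      (hR 0 p.1 * mehlerKernel a b p.1 q.1 * hR 0 q.1 / ∏ k, Real.sqrt (π / (a k + b k + π))) * (DZ p.2 * DZ q.2 / MZ)) ∧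
    (∀ p q : (σ → ℝ) × Z, p ∉ S ∨ q ∉ S → (S ×ˢ S).indicator (fun pq : ((σ → ℝ) × Z) × ((σ → ℝ) × Z) =>
      (hR 0 pq.1.1 * mehlerKernel a b pq.1.1 pq.2.1 * hR 0 pq.2.1 / ∏ k, Real.sqrt (π / (a k + b k + π))) * (DZ pq.1.2 * DZ pq.2.2 / MZ)) (p, q) = 0) := by
  obtain ⟨hJm, -, -, hJb, -⟩ := flatJ_admissible (Z := Z) ha hb hDZ hDZb hDZ0 hMZ
  have hL0 := lambda0_pos ha hb
  refine ⟨hJm.indicator (hS.prod hS), fun p q => ?_, fun p hp q hq => Set.indicator_of_mem (Set.mk_mem_prod hp hq) _, fun p q hpq => ?_⟩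
  · by_cases h : (p, q) ∈ S ×ˢ S
    · rw [Set.indicator_of_mem h]; exact hJb p q
    · rw [Set.indicator_of_notMem h, abs_zero]
      have hCZ : 0 ≤ CZ := (abs_nonneg _).trans (hDZb (p.2))
      exact mul_nonneg (div_nonneg (sq_nonneg _) hL0.le) (div_nonneg (mul_nonneg hCZ hCZ) hMZ.le)
  · refine Set.indicator_of_notMem (fun h => ?_) _
    rcases hpq with h1 | h1
    · exact h1 h.1
    · exact h1 h.2

/-- ★★★ **THE FLAT POINCARÉ INEQUALITY WITH CENSORING SLACK** — the `hflat` clause of `spec_gap_inputs` in flat coordinates.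
DATA: Mehler parameters `a_k, b_k > 0`, `a_k² + 2a_kb_k = π²`, contraction `b_k/s_k ≤ ρ < 1` (`0 ≤ ρ`); the stiff box `T = [−R,R]^σ` (`R > 0`) with
`ε_R = 2n·e^{−π(1−ρ)²R²} < 1`, window measure `μ = dy|_T`; a finite gauge factor `(Z, κ)` with weight `0 ≤ D_Z ≤ C_Z`, `M_Z = ∫D_Z dκ > 0`; a measurable support `S ⊆ T × Z`,
CORE-STABLE at scale `(t, W)` (`(y,z) ∈ S`, `|y'_k − ρ_ky_k| ≤ t`, `z' ∈ W` ⇒ `(y',z') ∈ S`) with `∫_S D > 0`, `ε_S = 2n·e^{−πt²} + κ[D_Z𝟙_{Wᶜ}]/M_Z`.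
OBJECTS: `D(y,z) = h₀(y)²D_Z(z)`; `J₀ = 𝟙_{S×S}·J_flat`, `J_flat((y,z),(y',z')) = h₀(y)K(y,y')h₀(y')/λ₀ · D_Z(z)D_Z(z')/M_Z`; `P = max(1/(1−ρ), 1/(1−ε_R))`.
CLAIM: for every bounded measurable `g` vanishing off `S`,
`∫_S g²D − (∫_S gD)²/∫_S D ≤ P·½∫∫(g(p)−g(q))²J₀(p,q) dν dν + (P·ε_S + ε_R/(1−ρ))·∫_S g²D`, `ν = μ ⊗ κ`.
PROOF: ✓`mehler_poincare_box` (hPY with slack `ε_R/(1−ρ)`) + ✓`mehlerJ_exit_row` (row floor `1−ε_R`) → ✓`variance_tensor_le_slack` → `productWeight_moments`/`productJump_eq` →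
✓`product_exit_mass_le` (exit `ε_S`) → `killed_transfer_door_slack`. [cite: Wipf2021, §8.5.1 (8.58)] [cite: FukushimaOshimaTakeda2011, §4.4] -/
theorem flat_poincare {a b : σ → ℝ} (ha : ∀ k, 0 < a k) (hb : ∀ k, 0 < b k) (hab : ∀ k, a k ^ 2 + 2 * a k * b k = π ^ 2)
    {ρ : ℝ} (hρ0 : 0 ≤ ρ) (hρ : ∀ k, b k / (a k + b k + π) ≤ ρ) (hρ1 : ρ < 1) {R : ℝ} (hRpos : 0 < R)
    (hεR : 2 * Fintype.card σ * Real.exp (-(π * ((1 - ρ) * R) ^ 2)) < 1)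
    {μ : Measure (σ → ℝ)} (hμT : μ = (volume : Measure (σ → ℝ)).restrict {y : σ → ℝ | ∀ k, |y k - 0| ≤ R})
    {DZ : Z → ℝ} (hDZ : Measurable DZ) {CZ : ℝ} (hDZb : ∀ z, |DZ z| ≤ CZ) (hDZ0 : ∀ z, 0 ≤ DZ z) (hMZ : 0 < ∫ z, DZ z ∂κ)
    {S : Set ((σ → ℝ) × Z)} (hS : MeasurableSet S) (hST : ∀ p ∈ S, ∀ k, |p.1 k - 0| ≤ R)
    {t : ℝ} (ht : 0 ≤ t) {W : Set Z} (hW : MeasurableSet W)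
    (hcore : ∀ p ∈ S, ∀ q : (σ → ℝ) × Z, (∀ k, |q.1 k - b k / (a k + b k + π) * p.1 k| ≤ t) → q.2 ∈ W → q ∈ S)
    (hZS : 0 < ∫ p in S, hR 0 p.1 ^ 2 * DZ p.2 ∂(μ.prod κ))
    {g : (σ → ℝ) × Z → ℝ} (hg : Measurable g) {Cg : ℝ} (hgb : ∀ p, |g p| ≤ Cg) (hgS : ∀ p, p ∉ S → g p = 0) :
    (∫ p in S, g p ^ 2 * (hR 0 p.1 ^ 2 * DZ p.2) ∂(μ.prod κ)) - (∫ p in S, g p * (hR 0 p.1 ^ 2 * DZ p.2) ∂(μ.prod κ)) ^ 2 /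
        (∫ p in S, hR 0 p.1 ^ 2 * DZ p.2 ∂(μ.prod κ)) ≤
      max (1 / (1 - ρ)) (1 / (1 - 2 * Fintype.card σ * Real.exp (-(π * ((1 - ρ) * R) ^ 2)))) *
          ((1 / 2) * ∫ p, ∫ q, (g p - g q) ^ 2 *
            (S ×ˢ S).indicator (fun pq : ((σ → ℝ) × Z) × ((σ → ℝ) × Z) =>
              (hR 0 pq.1.1 * mehlerKernel a b pq.1.1 pq.2.1 * hR 0 pq.2.1 / ∏ k, Real.sqrt (π / (a k + b k + π))) *
                (DZ pq.1.2 * DZ pq.2.2 / ∫ z, DZ z ∂κ)) (p, q) ∂(μ.prod κ) ∂(μ.prod κ)) +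
        (max (1 / (1 - ρ)) (1 / (1 - 2 * Fintype.card σ * Real.exp (-(π * ((1 - ρ) * R) ^ 2)))) *
            (2 * Fintype.card σ * Real.exp (-(π * t ^ 2)) + (∫ z in Wᶜ, DZ z ∂κ) / ∫ z, DZ z ∂κ) +
          1 / (1 - ρ) * (2 * Fintype.card σ * Real.exp (-(π * ((1 - ρ) * R) ^ 2)))) *
        ∫ p in S, g p ^ 2 * (hR 0 p.1 ^ 2 * DZ p.2) ∂(μ.prod κ) := by
  -- the inputs, instantiated before abbreviating
  have hbox := fun (h : (σ → ℝ) → ℝ) (hh : Measurable h) (C : ℝ) (hC : ∀ x, |h x| ≤ C) => mehler_poincare_box ha hb hab hρ0 hρ hρ1 hRpos hh hC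
  have hexit := fun (x : σ → ℝ) (hx : ∀ k, |x k - 0| ≤ R) => mehlerJ_exit_row ha hb hab hρ hρ1.le hRpos.le hx
  have hvolT := volume_box (fun _ : σ => (0 : ℝ)) hRpos
  have hT : MeasurableSet {y : σ → ℝ | ∀ k, |y k - 0| ≤ R} := measurableSet_box _ R
  subst hμT
  set T : Set (σ → ℝ) := {y : σ → ℝ | ∀ k, |y k - 0| ≤ R} with hTdef
  haveI : IsFiniteMeasure ((volume : Measure (σ → ℝ)).restrict T) := isFiniteMeasure_restrict.2 hvolT.1.ne
  obtain ⟨hJm, hJ0, hJsymm, hJb, hDm, hD0, hDb, hDint⟩ := mehlerJ_admissible ha hb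
  obtain ⟨hFm, hF0, hFsymm, hFb, hDDm, hDD0, hDDb⟩ := flatJ_admissible (Z := Z) ha hb hDZ hDZb hDZ0 hMZ
  obtain ⟨hF0m, hF0b, hin, hout⟩ := flatJ0_admissible (Z := Z) ha hb hDZ hDZb hDZ0 hMZ hS
  have hL0 := lambda0_pos ha hb
  have h1ρ : 0 < 1 - ρ := by linarith
  have hP : 0 ≤ 1 / (1 - ρ) := div_nonneg zero_le_one h1ρ.le
  have hεR0 : 0 ≤ 2 * Fintype.card σ * Real.exp (-(π * ((1 - ρ) * R) ^ 2)) := by positivity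
  have hr₀ : 0 < 1 - 2 * Fintype.card σ * Real.exp (-(π * ((1 - ρ) * R) ^ 2)) := by linarith
  -- the window weight `D_Y = 𝟙_T h₀²`
  set DY : (σ → ℝ) → ℝ := T.indicator fun y => hR 0 y ^ 2 with hDYdef
  have hDYm : Measurable DY := hDm.indicator hT
  have hDY_on : ∀ y ∈ T, DY y = hR 0 y ^ 2 := fun y hy => by rw [hDYdef, Set.indicator_of_mem hy]
  have hDY_off : ∀ y, y ∉ T → DY y = 0 := fun y hy => by rw [hDYdef, Set.indicator_of_notMem hy]
  have hDY0 : ∀ y, 0 ≤ DY y := fun y => by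
    by_cases hy : y ∈ T
    · rw [hDY_on y hy]; exact sq_nonneg _
    · rw [hDY_off y hy]
  have hDYb : ∀ y, |DY y| ≤ vacCoef σ ^ 2 := fun y => by
    by_cases hy : y ∈ T
    · rw [hDY_on y hy]; exact hDb y
    · rw [hDY_off y hy, abs_zero]; exact sq_nonneg _
  -- `∫ D_Y > 0`
  have hMY : 0 < ∫ y, DY y ∂((volume : Measure (σ → ℝ)).restrict T) := by
    rw [setIntegral_congr_fun hT hDY_on, integral_pos_iff_support_of_nonneg_ae (ae_of_all _ fun x => sq_nonneg (hR 0 x)) hDint.integrableOn]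
    have hsupp : Function.support (fun x : σ → ℝ => hR 0 x ^ 2) = Set.univ :=
      Set.eq_univ_of_forall fun x => by rw [Function.mem_support]; exact (pow_pos (hR_zero_pos_le x).1 2).ne'
    rw [hsupp, Measure.restrict_apply_univ]
    exact hvolT.2
  -- (i) the killed Mehler inequality on the box as `hPY`
  have hPY : ∀ h : (σ → ℝ) → ℝ, Measurable h → (∃ C : ℝ, ∀ y, |h y| ≤ C) →
      (∫ y, h y ^ 2 * DY y ∂((volume : Measure (σ → ℝ)).restrict T)) - (∫ y, h y * DY y ∂((volume : Measure (σ → ℝ)).restrict T)) ^ 2 /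
          (∫ y, DY y ∂((volume : Measure (σ → ℝ)).restrict T)) ≤
        (1 / (1 - ρ)) * ((1 / 2) * ∫ y, ∫ y', (h y - h y') ^ 2 * (hR 0 y * mehlerKernel a b y y' * hR 0 y' / ∏ k, Real.sqrt (π / (a k + b k + π)))
          ∂((volume : Measure (σ → ℝ)).restrict T) ∂((volume : Measure (σ → ℝ)).restrict T)) +
        (1 / (1 - ρ) * (2 * Fintype.card σ * Real.exp (-(π * ((1 - ρ) * R) ^ 2)))) * ∫ y, h y ^ 2 * DY y ∂((volume : Measure (σ → ℝ)).restrict T) := by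
    intro h hh hC
    obtain ⟨C, hC⟩ := hC
    have hbh := hbox h hh C hC
    have e1 : ∫ y, h y ^ 2 * DY y ∂((volume : Measure (σ → ℝ)).restrict T) = ∫ y in T, h y ^ 2 * hR 0 y ^ 2 :=
      setIntegral_congr_fun hT fun y hy => by rw [hDY_on y hy]
    have e2 : ∫ y, h y * DY y ∂((volume : Measure (σ → ℝ)).restrict T) = ∫ y in T, h y * hR 0 y ^ 2 :=
      setIntegral_congr_fun hT fun y hy => by rw [hDY_on y hy]
    have e3 : ∫ y, DY y ∂((volume : Measure (σ → ℝ)).restrict T) = ∫ y in T, hR 0 y ^ 2 := setIntegral_congr_fun hT hDY_on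
    rw [e1, e2, e3]
    linarith [hbh]
  -- (ii) the row floor
  have hRrow : ∀ y, (1 - 2 * Fintype.card σ * Real.exp (-(π * ((1 - ρ) * R) ^ 2))) * DY y ≤
      ∫ y', hR 0 y * mehlerKernel a b y y' * hR 0 y' / ∏ k, Real.sqrt (π / (a k + b k + π)) ∂((volume : Measure (σ → ℝ)).restrict T) := fun y => by
    by_cases hy : y ∈ T
    · rw [hDY_on y hy]; exact (hexit y hy).2
    · rw [hDY_off y hy, mul_zero]; exact integral_nonneg fun y' => hJ0 y y'
  -- (iii) tensorise
  have hδY : 0 ≤ 1 / (1 - ρ) * (2 * Fintype.card σ * Real.exp (-(π * ((1 - ρ) * R) ^ 2))) := mul_nonneg hP hεR0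
  have hT2 := variance_tensor_le_slack (μ := (volume : Measure (σ → ℝ)).restrict T) (κ := κ) hg hgb hDYm hDYb hDY0 hδY hDZ hDZb hDZ0 hJm hJb hJ0 hJsymm
    hP hr₀ hRrow hMY hMZ hPY
  -- (iv) product-measure form
  obtain ⟨m2, m1, m0⟩ := productWeight_moments (μ := (volume : Measure (σ → ℝ)).restrict T) (κ := κ) hDYm hDYb hDZ hDZb hg hgb
  have mj := productJump_eq (μ := (volume : Measure (σ → ℝ)).restrict T) (κ := κ) hDZ hDZb hJm hJb hg hgb (∫ z, DZ z ∂κ)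
  have hglob : (∫ p, g p ^ 2 * (DY p.1 * DZ p.2) ∂(((volume : Measure (σ → ℝ)).restrict T).prod κ)) -
      (∫ p, g p * (DY p.1 * DZ p.2) ∂(((volume : Measure (σ → ℝ)).restrict T).prod κ)) ^ 2 / (∫ p, DY p.1 * DZ p.2 ∂(((volume : Measure (σ → ℝ)).restrict T).prod κ)) ≤
      max (1 / (1 - ρ)) (1 / (1 - 2 * Fintype.card σ * Real.exp (-(π * ((1 - ρ) * R) ^ 2)))) *
        ((1 / 2) * ∫ p, ∫ q, (g p - g q) ^ 2 * ((hR 0 p.1 * mehlerKernel a b p.1 q.1 * hR 0 q.1 / ∏ k, Real.sqrt (π / (a k + b k + π))) *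
          (DZ p.2 * DZ q.2 / ∫ z, DZ z ∂κ)) ∂(((volume : Measure (σ → ℝ)).restrict T).prod κ) ∂(((volume : Measure (σ → ℝ)).restrict T).prod κ)) +
      (1 / (1 - ρ) * (2 * Fintype.card σ * Real.exp (-(π * ((1 - ρ) * R) ^ 2)))) * ∫ p, g p ^ 2 * (DY p.1 * DZ p.2) ∂(((volume : Measure (σ → ℝ)).restrict T).prod κ) := by
    rw [m2, m1, m0, mj]
    have e : max (1 / (1 - ρ)) (1 / (1 - 2 * Fintype.card σ * Real.exp (-(π * ((1 - ρ) * R) ^ 2)))) *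
        ((1 / 2) * ((1 / ∫ z, DZ z ∂κ) * ∫ y, ∫ y', (hR 0 y * mehlerKernel a b y y' * hR 0 y' / ∏ k, Real.sqrt (π / (a k + b k + π))) *
          (∫ z, ∫ z', (g (y, z) - g (y', z')) ^ 2 * (DZ z * DZ z') ∂κ ∂κ) ∂((volume : Measure (σ → ℝ)).restrict T) ∂((volume : Measure (σ → ℝ)).restrict T))) =
        (max (1 / (1 - ρ)) (1 / (1 - 2 * Fintype.card σ * Real.exp (-(π * ((1 - ρ) * R) ^ 2)))) / ∫ z, DZ z ∂κ) *
        ((1 / 2) * ∫ y, ∫ y', (hR 0 y * mehlerKernel a b y y' * hR 0 y' / ∏ k, Real.sqrt (π / (a k + b k + π))) *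
          (∫ z, ∫ z', (g (y, z) - g (y', z')) ^ 2 * (DZ z * DZ z') ∂κ ∂κ) ∂((volume : Measure (σ → ℝ)).restrict T) ∂((volume : Measure (σ → ℝ)).restrict T)) := by
      ring
    rw [e]
    exact hT2
  -- (v) exit mass of the flat kernel from `S`
  have hκS : ∀ p ∈ S, ∫ q in Sᶜ, (hR 0 p.1 * mehlerKernel a b p.1 q.1 * hR 0 q.1 / ∏ k, Real.sqrt (π / (a k + b k + π))) * (DZ p.2 * DZ q.2 / ∫ z, DZ z ∂κ)
      ∂(((volume : Measure (σ → ℝ)).restrict T).prod κ) ≤ (2 * Fintype.card σ * Real.exp (-(π * t ^ 2)) + (∫ z in Wᶜ, DZ z ∂κ) / ∫ z, DZ z ∂κ) * (DY p.1 * DZ p.2) :=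
    fun p hp => by
      rw [hDY_on p.1 (hST p hp)]
      exact product_exit_mass_le (μ := (volume : Measure (σ → ℝ)).restrict T) ha hb hab Measure.restrict_le_self hDZ hDZb hDZ0 hMZ hS ht hW hcore hp
  -- (vi) `∫_S D > 0` and measurability/bounds of `D_Y ⊗ D_Z`
  have hDind_on : ∀ p ∈ S, DY p.1 * DZ p.2 = hR 0 p.1 ^ 2 * DZ p.2 := fun p hp => by rw [hDY_on p.1 (hST p hp)]
  have hDindm : Measurable fun p : (σ → ℝ) × Z => DY p.1 * DZ p.2 := (hDYm.comp measurable_fst).mul (hDZ.comp measurable_snd)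
  have hDind0 : ∀ p : (σ → ℝ) × Z, 0 ≤ DY p.1 * DZ p.2 := fun p => mul_nonneg (hDY0 _) (hDZ0 _)
  have hDindb : ∀ p : (σ → ℝ) × Z, |DY p.1 * DZ p.2| ≤ vacCoef σ ^ 2 * CZ := fun p => by
    rw [abs_mul]; exact mul_le_mul (hDYb p.1) (hDZb p.2) (abs_nonneg _) ((abs_nonneg _).trans (hDYb p.1))
  have hZS' : 0 < ∫ p in S, DY p.1 * DZ p.2 ∂(((volume : Measure (σ → ℝ)).restrict T).prod κ) := by
    rw [setIntegral_congr_fun hS hDind_on]; exact hZS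
  have hPf : 0 ≤ max (1 / (1 - ρ)) (1 / (1 - 2 * Fintype.card σ * Real.exp (-(π * ((1 - ρ) * R) ^ 2)))) := hP.trans (le_max_left _ _)
  -- (vii) the killed transfer with slack
  have hfin := killed_transfer_door_slack (μ := ((volume : Measure (σ → ℝ)).restrict T).prod κ) hFm hFb hFsymm hg hgb hgS hS hDindm hDindb hDind0 hZS' hPf
    hin hout hκS hglob
  -- (viii) back to `D = h₀² ⊗ D_Z` on `S`
  have f1 : ∫ p in S, g p ^ 2 * (DY p.1 * DZ p.2) ∂(((volume : Measure (σ → ℝ)).restrict T).prod κ) =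
      ∫ p in S, g p ^ 2 * (hR 0 p.1 ^ 2 * DZ p.2) ∂(((volume : Measure (σ → ℝ)).restrict T).prod κ) :=
    setIntegral_congr_fun hS fun p hp => by rw [hDind_on p hp]
  have f2 : ∫ p in S, g p * (DY p.1 * DZ p.2) ∂(((volume : Measure (σ → ℝ)).restrict T).prod κ) =
      ∫ p in S, g p * (hR 0 p.1 ^ 2 * DZ p.2) ∂(((volume : Measure (σ → ℝ)).restrict T).prod κ) :=
    setIntegral_congr_fun hS fun p hp => by rw [hDind_on p hp]
  rw [f1, f2, setIntegral_congr_fun hS hDind_on] at hfin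
  exact hfin

/-- ★★ **β-FREE CONSTANTS.**  In `flat_poincare`, if moreover `ε_R ≤ 1/2`, then with `P₀ = 2/(1−ρ)` (a function of the contraction `ρ` alone — for the (B-ST) pen
`ρ = mehlerRatio g₀(L)`, ✓`…MehlerScaling`):  `∫_S g²D − (∫_S gD)²/∫_S D ≤ P₀·½∫∫(g(p)−g(q))²J₀ + P₀·(ε_S + ε_R)·∫_S g²D`, and the slack rate
`δ = P₀(ε_S + ε_R) = P₀·(2n·e^{−πt²} + κ[D_Z𝟙_{Wᶜ}]/M_Z + 2n·e^{−π(1−ρ)²R²})` tends to `0` as the box, the core scale and the gauge window grow. [cite: Wipf2021, §8.5.1 (8.58)] -/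
theorem flat_poincare_betaFree {a b : σ → ℝ} (ha : ∀ k, 0 < a k) (hb : ∀ k, 0 < b k) (hab : ∀ k, a k ^ 2 + 2 * a k * b k = π ^ 2)
    {ρ : ℝ} (hρ0 : 0 ≤ ρ) (hρ : ∀ k, b k / (a k + b k + π) ≤ ρ) (hρ1 : ρ < 1) {R : ℝ} (hRpos : 0 < R)
    (hεR : 2 * Fintype.card σ * Real.exp (-(π * ((1 - ρ) * R) ^ 2)) ≤ 1 / 2)
    {μ : Measure (σ → ℝ)} (hμT : μ = (volume : Measure (σ → ℝ)).restrict {y : σ → ℝ | ∀ k, |y k - 0| ≤ R})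
    {DZ : Z → ℝ} (hDZ : Measurable DZ) {CZ : ℝ} (hDZb : ∀ z, |DZ z| ≤ CZ) (hDZ0 : ∀ z, 0 ≤ DZ z) (hMZ : 0 < ∫ z, DZ z ∂κ)
    {S : Set ((σ → ℝ) × Z)} (hS : MeasurableSet S) (hST : ∀ p ∈ S, ∀ k, |p.1 k - 0| ≤ R)
    {t : ℝ} (ht : 0 ≤ t) {W : Set Z} (hW : MeasurableSet W)
    (hcore : ∀ p ∈ S, ∀ q : (σ → ℝ) × Z, (∀ k, |q.1 k - b k / (a k + b k + π) * p.1 k| ≤ t) → q.2 ∈ W → q ∈ S)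
    (hZS : 0 < ∫ p in S, hR 0 p.1 ^ 2 * DZ p.2 ∂(μ.prod κ))
    {g : (σ → ℝ) × Z → ℝ} (hg : Measurable g) {Cg : ℝ} (hgb : ∀ p, |g p| ≤ Cg) (hgS : ∀ p, p ∉ S → g p = 0) :
    (∫ p in S, g p ^ 2 * (hR 0 p.1 ^ 2 * DZ p.2) ∂(μ.prod κ)) - (∫ p in S, g p * (hR 0 p.1 ^ 2 * DZ p.2) ∂(μ.prod κ)) ^ 2 /
        (∫ p in S, hR 0 p.1 ^ 2 * DZ p.2 ∂(μ.prod κ)) ≤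
      2 / (1 - ρ) * ((1 / 2) * ∫ p, ∫ q, (g p - g q) ^ 2 *
            (S ×ˢ S).indicator (fun pq : ((σ → ℝ) × Z) × ((σ → ℝ) × Z) =>
              (hR 0 pq.1.1 * mehlerKernel a b pq.1.1 pq.2.1 * hR 0 pq.2.1 / ∏ k, Real.sqrt (π / (a k + b k + π))) *
                (DZ pq.1.2 * DZ pq.2.2 / ∫ z, DZ z ∂κ)) (p, q) ∂(μ.prod κ) ∂(μ.prod κ)) +
        2 / (1 - ρ) * ((2 * Fintype.card σ * Real.exp (-(π * t ^ 2)) + (∫ z in Wᶜ, DZ z ∂κ) / ∫ z, DZ z ∂κ) +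
            2 * Fintype.card σ * Real.exp (-(π * ((1 - ρ) * R) ^ 2))) *
          ∫ p in S, g p ^ 2 * (hR 0 p.1 ^ 2 * DZ p.2) ∂(μ.prod κ) := by
  have h := flat_poincare (κ := κ) ha hb hab hρ0 hρ hρ1 hRpos (hεR.trans_lt (by norm_num)) hμT hDZ hDZb hDZ0 hMZ hS hST ht hW hcore hZS hg hgb hgS
  obtain ⟨-, hF0, -⟩ := flatJ_admissible (Z := Z) ha hb hDZ hDZb hDZ0 hMZ
  have h1ρ : 0 < 1 - ρ := by linarith
  -- the two non-negative quantities
  have hE : 0 ≤ (1 / 2) * ∫ p, ∫ q, (g p - g q) ^ 2 *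
      (S ×ˢ S).indicator (fun pq : ((σ → ℝ) × Z) × ((σ → ℝ) × Z) =>
        (hR 0 pq.1.1 * mehlerKernel a b pq.1.1 pq.2.1 * hR 0 pq.2.1 / ∏ k, Real.sqrt (π / (a k + b k + π))) *
          (DZ pq.1.2 * DZ pq.2.2 / ∫ z, DZ z ∂κ)) (p, q) ∂(μ.prod κ) ∂(μ.prod κ) :=
    mul_nonneg (by norm_num) (integral_nonneg fun p => integral_nonneg fun q =>
      mul_nonneg (sq_nonneg _) (Set.indicator_nonneg (fun pq _ => hF0 pq.1 pq.2) _))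
  have hI : 0 ≤ ∫ p in S, g p ^ 2 * (hR 0 p.1 ^ 2 * DZ p.2) ∂(μ.prod κ) :=
    integral_nonneg fun p => mul_nonneg (sq_nonneg _) (mul_nonneg (sq_nonneg _) (hDZ0 _))
  -- the constants
  have hεR0 : 0 ≤ 2 * Fintype.card σ * Real.exp (-(π * ((1 - ρ) * R) ^ 2)) := by positivity
  have hεS0 : 0 ≤ 2 * Fintype.card σ * Real.exp (-(π * t ^ 2)) + (∫ z in Wᶜ, DZ z ∂κ) / ∫ z, DZ z ∂κ :=
    add_nonneg (by positivity) (div_nonneg (integral_nonneg fun z => hDZ0 z) hMZ.le)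
  have hP1 : 1 / (1 - ρ) ≤ 2 / (1 - ρ) := div_le_div_of_nonneg_right (by norm_num) h1ρ.le
  have hP2 : 1 / (1 - 2 * Fintype.card σ * Real.exp (-(π * ((1 - ρ) * R) ^ 2))) ≤ 2 / (1 - ρ) := by
    rw [div_le_div_iff₀ (by linarith) h1ρ]
    nlinarith
  have hmax : max (1 / (1 - ρ)) (1 / (1 - 2 * Fintype.card σ * Real.exp (-(π * ((1 - ρ) * R) ^ 2)))) ≤ 2 / (1 - ρ) := max_le hP1 hP2
  have hmax0 : 0 ≤ max (1 / (1 - ρ)) (1 / (1 - 2 * Fintype.card σ * Real.exp (-(π * ((1 - ρ) * R) ^ 2)))) :=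
    (div_nonneg zero_le_one h1ρ.le).trans (le_max_left _ _)
  have hcoef : max (1 / (1 - ρ)) (1 / (1 - 2 * Fintype.card σ * Real.exp (-(π * ((1 - ρ) * R) ^ 2)))) *
        (2 * Fintype.card σ * Real.exp (-(π * t ^ 2)) + (∫ z in Wᶜ, DZ z ∂κ) / ∫ z, DZ z ∂κ) +
      1 / (1 - ρ) * (2 * Fintype.card σ * Real.exp (-(π * ((1 - ρ) * R) ^ 2))) ≤
      2 / (1 - ρ) * ((2 * Fintype.card σ * Real.exp (-(π * t ^ 2)) + (∫ z in Wᶜ, DZ z ∂κ) / ∫ z, DZ z ∂κ) +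
        2 * Fintype.card σ * Real.exp (-(π * ((1 - ρ) * R) ^ 2))) := by
    have t1 := mul_le_mul_of_nonneg_right hmax hεS0
    have t2 := mul_le_mul_of_nonneg_right hP1 hεR0
    linarith
  exact h.trans (add_le_add (mul_le_mul_of_nonneg_right hmax hE) (mul_le_mul_of_nonneg_right hcoef hI))

end FlatChain

end Summit.QuantumFields.YangMills.Theorems.FemtoTransferGap.Mehler

end
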